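import Literature.Analysis.FluidPDE.TypeIAncientMild
import Literature.Analysis.FluidPDE.ScalingUniformRecurrence

/-!
# Crux `FiniteDissipationLiouville` (stmt-NavierStokesRegularity-22144), negative side:
# on discretely self-similar fields "bounded at the apex" IS "identically zero"

Negative-side (cdisprove) support for the lead's line on the crux `FiniteDissipationLiouville`
(route `LerayQuarterDissipation`), whose DSS leaf `stub_dssExclusion` asks that `λ`-DSS members of
the dissipative Type-I class be bounded at the apex. This file records, kernel-checked, that on a
`λ`-discretely self-similar field (`Literature.Analysis.FluidPDE.IsDiscretelySelfSimilar`,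
`u(t,x) = λ u(λ²t, λx)`, `1 < λ`) the crux's conclusion "bounded at the apex `(0,0)`" is
EQUIVALENT to vanishing on the whole past:

* `dss_apply_zoom` — the exact zoom law `u(t/λ^{2k}, x/λ^k) = λ^k u(t,x)`;
* `eq_zero_of_dss_of_not_singularAtApex` — a `λ`-DSS field bounded in some backward cylinder
  `(−r², 0) × B_r` vanishes at every `t < 0` (zoom any nonzero value into the cylinder and let
  `k → ∞`); `singularAtApex_of_dss_ne_zero` — contrapositive;
* `dssExclusion_iff_dssLiouville` — consequently the DSS leaf of the crux (regularity form) is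
  LETTER FOR LETTER EQUIVALENT to the Liouville theorem "every `λ`-DSS member of the dissipative
  Type-I mild class is `0`", i.e. to the backward `λ`-DSS Liouville problem (Bradshaw–Tsai 2017,
  Open Problem 5.1; Chae–Wolf 2017, Thm 1.3 only for `λ ∈ (1, λ_*(C))`) restricted to profiles
  obeying Leray's quarter-rate dissipation law: partial regularity offers no shortcut on this leaf,
  and a proof of the leaf for all `λ > 1` would settle that open problem on the dissipative stratum.

No new definitions and no route import (the crux's clauses are inlined verbatim, so the file is
route-independent and importable by skeletons). Standard axioms.

References: D. Chae, J. Wolf, arXiv:1610.09464, Thm 1.3, Rem. 1.4; Z. Bradshaw, T.-P. Tsai,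
Comm. PDE 42 (2017), §5, Open Problem 5.1.
-/

noncomputable section

open Set Function Filter MeasureTheory
open scoped Topology ENNReal

namespace Summit.NavierStokesRegularity.NavierStokesRegularity.Theorems.FiniteDissipationLiouville.Negative

open Literature.Analysis.FluidPDE

/-- **Exact zoom law** of a `λ`-DSS field (`0 < λ`): `u(t/L², L⁻¹x) = L u(t,x)` with `L = λ^k`. -/
theorem dss_apply_zoom {lam : ℝ} (hlam : 0 < lam) {u : ℝ → EuclideanSpace ℝ (Fin 3) → EuclideanSpace ℝ (Fin 3)}
    (hu : IsDiscretelySelfSimilar lam u) (k : ℕ) (t : ℝ) (x : EuclideanSpace ℝ (Fin 3)) :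
    u (t / (lam ^ k) ^ 2) ((lam ^ k)⁻¹ • x) = lam ^ k • u t x := by
  have hL : (lam ^ k) ≠ 0 := pow_ne_zero k hlam.ne'
  have h := congrFun (congrFun (BradshawTsai2019.isDiscretelySelfSimilar_pow hu k)
    (t / (lam ^ k) ^ 2)) ((lam ^ k)⁻¹ • x)
  rw [nsRescale_apply, mul_div_cancel₀ _ (pow_ne_zero 2 hL), smul_inv_smul₀ hL] at h
  exact h.symm

/-- **A `λ`-DSS field bounded at the apex vanishes on the past.** If `u(t,x) = λu(λ²t, λx)`
(`1 < λ`) and `‖u‖ ≤ M` on some backward cylinder `(−r², 0) × B_r` (the negation of the crux's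
"singular at the apex"), then `u(t, ·) = 0` for every `t < 0`: a nonzero value `u(t,x)` zooms to
`λ^k u(t,x)` at `(t/λ^{2k}, x/λ^k)`, inside the cylinder for large `k`, contradicting the bound. -/
theorem eq_zero_of_dss_of_not_singularAtApex {lam : ℝ} (hlam : 1 < lam) {u : ℝ → EuclideanSpace ℝ (Fin 3) → EuclideanSpace ℝ (Fin 3)}
    (hu : IsDiscretelySelfSimilar lam u)
    (hns : ¬ (∀ r > 0, ∀ M : ℝ, ∃ t ∈ Set.Ioo (-(r ^ 2)) (0 : ℝ),
      ∃ x ∈ Metric.ball (0 : EuclideanSpace ℝ (Fin 3)) r, M < ‖u t x‖)) :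
    ∀ t < 0, ∀ x, u t x = 0 := by
  push Not at hns
  obtain ⟨r, hr, M, hM⟩ := hns
  intro t₀ ht₀ x₀
  by_contra hne
  have ha : 0 < ‖u t₀ x₀‖ := norm_pos_iff.2 hne
  have hlam0 : 0 < lam := by linarith
  have hT : Tendsto (fun k : ℕ => lam ^ k) atTop atTop := tendsto_pow_atTop_atTop_of_one_lt hlam
  obtain ⟨k, hk1, hk2, hk3⟩ := ((hT.eventually_gt_atTop (‖x₀‖ / r)).and
    ((hT.eventually_gt_atTop (M / ‖u t₀ x₀‖)).and (hT.eventually_gt_atTop (-t₀ / r ^ 2)))).exists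
  set L : ℝ := lam ^ k with hL
  have hL0 : 0 < L := pow_pos hlam0 k
  have hL1 : 1 ≤ L := one_le_pow₀ hlam.le
  have key : u (t₀ / L ^ 2) (L⁻¹ • x₀) = L • u t₀ x₀ := dss_apply_zoom hlam0 hu k t₀ x₀
  have hr2 : (0 : ℝ) < r ^ 2 := by positivity
  have ht_mem : t₀ / L ^ 2 ∈ Set.Ioo (-(r ^ 2)) 0 := by
    refine ⟨?_, div_neg_of_neg_of_pos ht₀ (by positivity)⟩
    have h3 : -t₀ < L * r ^ 2 := by
      have := (div_lt_iff₀ hr2).1 hk3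
      linarith
    have hLL : L * r ^ 2 ≤ L ^ 2 * r ^ 2 := by nlinarith
    rw [lt_div_iff₀ (by positivity)]
    linarith
  have hx_mem : L⁻¹ • x₀ ∈ Metric.ball (0 : EuclideanSpace ℝ (Fin 3)) r := by
    rw [Metric.mem_ball, dist_zero_right, norm_smul, norm_inv, Real.norm_eq_abs, abs_of_pos hL0,
      inv_mul_lt_iff₀ hL0]
    have := (div_lt_iff₀ hr).1 hk1
    linarith
  have hbd := hM _ ht_mem _ hx_mem
  rw [key, norm_smul, Real.norm_eq_abs, abs_of_pos hL0] at hbd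
  have h2 : M < L * ‖u t₀ x₀‖ := by
    have := (div_lt_iff₀ ha).1 hk2
    linarith
  linarith

/-- Contrapositive: a `λ`-DSS field (`1 < λ`) with one nonzero value on the past is singular at
the apex in the sense of the crux. -/
theorem singularAtApex_of_dss_ne_zero {lam : ℝ} (hlam : 1 < lam) {u : ℝ → EuclideanSpace ℝ (Fin 3) → EuclideanSpace ℝ (Fin 3)}
    (hu : IsDiscretelySelfSimilar lam u) (h : ∃ t < 0, ∃ x, u t x ≠ 0) :
    ∀ r > 0, ∀ M : ℝ, ∃ t ∈ Set.Ioo (-(r ^ 2)) (0 : ℝ),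
      ∃ x ∈ Metric.ball (0 : EuclideanSpace ℝ (Fin 3)) r, M < ‖u t x‖ := by
  by_contra hns
  obtain ⟨t, ht, x, hx⟩ := h
  exact hx (eq_zero_of_dss_of_not_singularAtApex hlam hu hns t ht x)

/-- **The DSS leaf of the crux is a Liouville theorem.** Over the dissipative Type-I mild class of
`FiniteDissipationLiouville` (hypotheses inlined verbatim), "every `λ`-DSS member is bounded at the
apex" and "every `λ`-DSS member vanishes on the past" are equivalent (`1 < λ`): the regularity
form of the leaf `stub_dssExclusion` is exactly the backward `λ`-DSS Liouville problem
(Bradshaw–Tsai 2017, Open Problem 5.1; known only for `λ ∈ (1, λ_*(C))`, Chae–Wolf 2017 Thm 1.3)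
restricted to profiles with Leray's quarter-rate dissipation. -/
theorem dssExclusion_iff_dssLiouville :
    (∀ (C K lam : ℝ) (u : ℝ → EuclideanSpace ℝ (Fin 3) → EuclideanSpace ℝ (Fin 3)), 1 < lam → IsTypeIAncientMild C u →
        (∀ s : ℝ, s < 0 → ∫⁻ x, ‖fderiv ℝ (u s) x‖ₑ ^ 2 ≤ ENNReal.ofReal (K / Real.sqrt (-s))) →
        IsDiscretelySelfSimilar lam u →
        ¬ (∀ r > 0, ∀ M : ℝ, ∃ t ∈ Set.Ioo (-(r ^ 2)) (0 : ℝ),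
            ∃ x ∈ Metric.ball (0 : EuclideanSpace ℝ (Fin 3)) r, M < ‖u t x‖)) ↔
    (∀ (C K lam : ℝ) (u : ℝ → EuclideanSpace ℝ (Fin 3) → EuclideanSpace ℝ (Fin 3)), 1 < lam → IsTypeIAncientMild C u →
        (∀ s : ℝ, s < 0 → ∫⁻ x, ‖fderiv ℝ (u s) x‖ₑ ^ 2 ≤ ENNReal.ofReal (K / Real.sqrt (-s))) →
        IsDiscretelySelfSimilar lam u → ∀ t < 0, ∀ x, u t x = 0) :=
  ⟨fun h C K lam u hlam hu hD hdss =>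
      eq_zero_of_dss_of_not_singularAtApex hlam hdss (h C K lam u hlam hu hD hdss),
    fun h C K lam u hlam hu hD hdss hsing => by
      obtain ⟨t, ht, x, -, hM⟩ := hsing 1 one_pos 0
      rw [h C K lam u hlam hu hD hdss t ht.2 x, norm_zero] at hM
      exact lt_irrefl 0 hM⟩

end Summit.NavierStokesRegularity.NavierStokesRegularity.Theorems.FiniteDissipationLiouville.Negative

end
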